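import Mathlib.Topology.Instances.Matrix
import Summits.Ventures.HSemireg.WedgeHankelRecurrenceHankelTotallyNonnegative

/-!
# Venture HSemireg — **HANKEL MATRICES OF NONNEGATIVE ATOMIC MEASURES ON `[0, ∞)` ARE TOTALLY NONNEGATIVE** — the closed case of N260 (gen 41 OPEN item (f)): masses `μ_j ≥ 0`, nodes
# `v_j ≥ 0` (an atom AT THE ORIGIN allowed, repetitions and any order allowed) ⇒ every minor of `(Σ_j μ_j v_j^{i+k})` on increasing rows ∕ columns is `≥ 0` and every finite section is
# `IsTN`; by CONTINUITY: shift all nodes by `ε > 0` (N260 applies), let `ε → 0⁺`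

HONEST FRAMING. Part of the Lean index of the computation cell `pub-hsemireg` (seat p10 gen 42, Sunday typer «UNIFORM-IN-n»).  Real determinants, finite sums and one limit
(`Continuous.matrix_det`, `ge_of_tendsto`); no variety, no cohomology theory, no sheaf, no Ext group and no semiregularity map is constructed here; nothing here says that HC / HC_CM / HC_AV
holds; no Literature fact (unproved `Prop`) is declared or used.  Custodian versions as in `WedgeHankelSiegelIdeal` (1/3).
SOURCES (cited).  F. R. Gantmacher, *The Theory of Matrices* II, Ch. XV §16.2 Definition 4 (degenerate data); F. R. Gantmacher, M. G. Krein, *Oscillation Matrices and Kernels*, Ch. II §3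
(the totally nonnegative matrices form the CLOSURE of the totally positive ones); S. M. Fallat, C. R. Johnson, *Totally Nonnegative Matrices* (2011), §0.0 and Thm 2.6 (density of TP in TN);
S. Karlin, *Total Positivity* I (1968), Ch. 2 §2.
PROOF TYPED HERE.  `ε ↦ det (Σ_j μ_j (v_j + ε)^{r_a + c_b})_{a,b}` is continuous (polynomial entries), `≥ 0` for `ε > 0` by N260 (`v_j + ε > 0`), hence `≥ 0` at `ε = 0` (`ge_of_tendsto` along `𝓝[>] 0`).
DEDUP DISCLOSURE (`rg -n 'of_nonneg|Closed' Summits/Ventures/HSemireg/WedgeHankelRecurrenceHankelTotallyNonnegative.lean`, 2026-09-02): N260 requires `v_j > 0` (its CAVEATS line names the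
origin as not covered).  The 4 names below: 0 hits tree-wide.

WHAT IS IN THE TREE.  N260 `det_hankelMinor_sum_mul_pow_nonneg`; Literature `Literature.LinearAlgebra.Matrix.IsTN`; Mathlib `Continuous.matrix_det`, `continuous_matrix`, `ge_of_tendsto`,
`eventually_nhdsWithin_of_forall`.
THIS FILE (namespace `Summit.Ventures.HSemireg.Wedge.HankelOuter` continued; CHAINED on N260; 0 definitions):
* §1048 **`det_hankelMinor_sum_mul_pow_nonneg_of_nonneg`** (`μ ≥ 0`, `v ≥ 0`), `det_hankelMinor_nonneg_of_moments_of_nonneg`, **`isTN_hankelSection_of_moments_of_nonneg`**,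
  `isTN_hankelBlock_of_moments_of_nonneg`.
CAVEATS.  Nothing Ext-side.  New names only.
-/

open Module Polynomial Filter
open scoped Matrix Polynomial Topology

namespace Summit.Ventures.HSemireg.Wedge.HankelOuter

open Literature.LinearAlgebra.Matrix (IsTN)

/-! ## §1048. The closed case: atoms at the origin -/

/-- **Every minor of the Hankel matrix of a nonnegative combination of nonnegative geometric sequences is `≥ 0`**: for `μ_j ≥ 0`, `v_j ≥ 0` (any order, repetitions, atoms at `0` allowed)
and strictly increasing rows `r`, columns `c`: `0 ≤ det (Σ_j μ_j v_j^{r_a + c_b})_{a,b}`. [Gantmacher XV §16 Def 4; Gantmacher–Krein II §3 (TN = closure of TP); this file, §1048] -/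
theorem det_hankelMinor_sum_mul_pow_nonneg_of_nonneg {m h : ℕ} {μ v : Fin m → ℝ} (hμ : ∀ j, 0 ≤ μ j) (hv : ∀ j, 0 ≤ v j) {r c : Fin h → ℕ} (hr : StrictMono r) (hc : StrictMono c) :
    0 ≤ (Matrix.of fun a b : Fin h => ∑ j, μ j * v j ^ (r a + c b)).det := by
  -- shift the nodes by `ε` and let `ε → 0⁺`
  set f : ℝ → ℝ := fun ε => (Matrix.of fun a b : Fin h => ∑ j, μ j * (v j + ε) ^ (r a + c b)).det with hf
  have hcont : Continuous f := by
    refine Continuous.matrix_det (continuous_matrix fun a b => ?_)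
    show Continuous fun ε : ℝ => ∑ j, μ j * (v j + ε) ^ (r a + c b)
    exact continuous_finsetSum _ fun j _ => (continuous_const.mul ((continuous_const.add continuous_id).pow _))
  have hpos : ∀ ε : ℝ, 0 < ε → 0 ≤ f ε := fun ε hε => det_hankelMinor_sum_mul_pow_nonneg hμ (fun j => add_pos_of_nonneg_of_pos (hv j) hε) hr hc
  have hlim : Tendsto f (𝓝[>] 0) (𝓝 (f 0)) := hcont.continuousAt.tendsto.mono_left nhdsWithin_le_nhds
  have h0 : 0 ≤ f 0 := ge_of_tendsto hlim (eventually_nhdsWithin_of_forall fun ε hε => hpos ε hε)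
  simpa [hf] using h0

/-- The same for a sequence given by its moments `s_p = Σ_j μ_j v_j^p` with `μ ≥ 0`, `v ≥ 0`. [this file, §1048] -/
theorem det_hankelMinor_nonneg_of_moments_of_nonneg {m h : ℕ} {s : ℕ → ℝ} {μ v : Fin m → ℝ} (hμ : ∀ j, 0 ≤ μ j) (hv : ∀ j, 0 ≤ v j) (hs : ∀ p, s p = ∑ j, μ j * v j ^ p)
    {r c : Fin h → ℕ} (hr : StrictMono r) (hc : StrictMono c) : 0 ≤ (Matrix.of fun a b : Fin h => s (r a + c b)).det := by
  have hmat : (Matrix.of fun a b : Fin h => s (r a + c b)) = Matrix.of fun a b : Fin h => ∑ j, μ j * v j ^ (r a + c b) := by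
    ext a b
    simp only [Matrix.of_apply, hs]
  rw [hmat]
  exact det_hankelMinor_sum_mul_pow_nonneg_of_nonneg hμ hv hr hc

/-- **Every finite section of the Hankel matrix of a nonnegative atomic measure on `[0, ∞)` is TOTALLY NONNEGATIVE (`IsTN`).** [Gantmacher XV §16 Def 4; Fallat–Johnson §0.0; this file, §1048] -/
theorem isTN_hankelSection_of_moments_of_nonneg {m : ℕ} {s : ℕ → ℝ} {μ v : Fin m → ℝ} (hμ : ∀ j, 0 ≤ μ j) (hv : ∀ j, 0 ≤ v j) (hs : ∀ p, s p = ∑ j, μ j * v j ^ p) (p q : ℕ) :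
    IsTN (Matrix.of fun (i : Fin p) (k : Fin q) => s ((i : ℕ) + (k : ℕ))) := by
  intro j r c hr hc
  have hmat : (Matrix.of fun (i : Fin p) (k : Fin q) => s ((i : ℕ) + (k : ℕ))).submatrix r c = Matrix.of fun a b : Fin j => s ((fun a => (r a : ℕ)) a + (fun b => (c b : ℕ)) b) := by
    ext a b
    simp only [Matrix.submatrix_apply, Matrix.of_apply]
  rw [hmat]
  exact det_hankelMinor_nonneg_of_moments_of_nonneg hμ hv hs (fun a b hab => hr hab) (fun a b hab => hc hab)

/-- In particular the `(t+1) × (t+2)` block of such a sequence is `IsTN`. [this file, §1048] -/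
theorem isTN_hankelBlock_of_moments_of_nonneg {m t : ℕ} {s : ℕ → ℝ} {μ v : Fin m → ℝ} (hμ : ∀ j, 0 ≤ μ j) (hv : ∀ j, 0 ≤ v j) (hs : ∀ p, s p = ∑ j, μ j * v j ^ p) :
    IsTN (Matrix.of fun (i : Fin (t + 1)) (k : Fin (t + 2)) => s ((i : ℕ) + (k : ℕ))) :=
  isTN_hankelSection_of_moments_of_nonneg hμ hv hs (t + 1) (t + 2)

end Summit.Ventures.HSemireg.Wedge.HankelOuter
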